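import Summits.ResolutionOfSingularities.ResolutionOfSingularities.Theorems.HilbertSamuelEliminationSigmaMaxModificationsCorridor3SigmaMenuStrategy
import Summits.ResolutionOfSingularities.ResolutionOfSingularities.Theorems.HilbertSamuelEliminationSigmaMaxModificationsCorridor3SigmaBoundaryCompactnessStates
import HarnessLib

/-!
# [OURS · L1 W4.2] σ-LAYER — `Corridor3SigmaMenuNonempty`: menu-disciplined strategies STEP ONLY WHILE THE `ν`-STRATUM IS NON-EMPTY
# (RULING v3.14-15 (DX): «o1: prove `StepsOnlyWhileNonempty` for `StrategyE.IsMenuDisciplinedOver` strategies or say it is a clause of the discipline»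
# — it IS a consequence of the discipline: a menu step is taken AT a point of `X(ν)`)

Crux chain w42 (`SigmaMaxModifications`, stmt-ResolutionOfSingularities-18506; conjunct `SigmaMaxModificationsCorridor3`, stmt-ResolutionOfSingularities-19249),
σ-layer (E2)/(E5). Typer res-L1-type-o1 (OURS typer G4) over its `…Corridor3SigmaMenuDiscipline` (p526241) / `…Corridor3SigmaMenuStrategy` (p527045) and
res-D-pv-047's `…Corridor3SigmaBoundaryCompactnessStates` (p525937: `StrategyE.StepsOnlyWhileNonempty`, the hypothesis of the σE-compactness package
`exists_nearChainσE_of_runInfiniteσE` / `nuMod_of_runTerminatesσE`). OURS (cell res-hironaka, slot W4.2); NOT statements of H. Hironaka's manuscript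
[Hironaka2017] nor of [CossartJannsenSaito2020]; AI-typed, weaker than expert review. Helper `--supports stmt-ResolutionOfSingularities-19249 --as helper`
(counted 0). Theorem-only; no row claimed.

CONTENTS: `IsDisciplinedBy.stepsOnlyWhileNonempty` (any menu), `IsDisciplinedByOver.stepsOnlyWhileNonempty` (needs it of the fallback),
`StrategyE.stepsOnlyWhileNonempty_hybrid` (policy + fallback), `IsDisciplinedBy.stepsOnlyWhileNonempty_hybrid` (disciplined policy + fallback with the
property), and the instances `IsMenuDisciplined.stepsOnlyWhileNonempty`, `IsMenuDisciplinedOver.stepsOnlyWhileNonempty`, `IsMenuDisciplined.stepsOnlyWhileNonempty_hybrid`.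
For the fallbacks of record the property is 047's `StrategyE.stepsOnlyWhileNonempty_ofStageOracleE` / `…_withBoundary_ofStageOracle`.
-/

noncomputable section

set_option linter.dupNamespace false

open CategoryTheory AlgebraicGeometry TopologicalSpace
open Summit.ResolutionOfSingularities.ResolutionOfSingularities.Theorems.CampaignW42
open Literature.AlgebraicGeometry.Resolution Literature.RingTheory.HilbertSamuel

namespace Summit.ResolutionOfSingularities.ResolutionOfSingularities.Theorems.SigmaMaxModificationsCorridor3.Sigma

universe u

variable {M : CentreMenu.{u}} {N : ℕ} {ν : ℕ → ℕ} {σ τ π : StrategyE.{u}}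

/-- **A strategy disciplined by ANY menu steps only while the `ν`-stratum is non-empty**: its step is taken at a point of `X(ν)`. [folklore] -/
theorem StrategyE.IsDisciplinedBy.stepsOnlyWhileNonempty (h : σ.IsDisciplinedBy M N ν) : σ.StepsOnlyWhileNonempty N ν := by
  intro W hW L P E C P' hstep
  obtain ⟨x, hx, -⟩ := h W hW L P E C P' hstep
  exact ⟨x, hx⟩

/-- **A hybrid-shaped strategy (disciplined over a fallback) steps only while the stratum is non-empty, provided the fallback does.** [folklore] -/
theorem StrategyE.IsDisciplinedByOver.stepsOnlyWhileNonempty (h : StrategyE.IsDisciplinedByOver M N ν τ σ) (hτ : τ.StepsOnlyWhileNonempty N ν) :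
    σ.StepsOnlyWhileNonempty N ν := by
  intro W hW L P E C P' hstep
  rcases h W hW L P E C P' hstep with ⟨x, hx, -⟩ | hτstep
  · exact ⟨x, hx⟩
  · exact hτ W hW L P E C P' hτstep

/-- The hybrid of two strategies with the property has the property. [folklore] -/
theorem StrategyE.stepsOnlyWhileNonempty_hybrid (hπ : π.StepsOnlyWhileNonempty N ν) (hτ : τ.StepsOnlyWhileNonempty N ν) :
    (π.hybrid τ).StepsOnlyWhileNonempty N ν := by
  intro W hW L P E C P' hstep
  rcases StrategyE.hybrid_step_cases hstep with h | h
  · exact hπ W hW L P E C P' h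
  · exact hτ W hW L P E C P' h

/-- The hybrid of a DISCIPLINED policy over a fallback with the property has the property. [folklore] -/
theorem StrategyE.IsDisciplinedBy.stepsOnlyWhileNonempty_hybrid (hπ : π.IsDisciplinedBy M N ν) (hτ : τ.StepsOnlyWhileNonempty N ν) :
    (π.hybrid τ).StepsOnlyWhileNonempty N ν :=
  StrategyE.stepsOnlyWhileNonempty_hybrid hπ.stepsOnlyWhileNonempty hτ

/-- **Menu-disciplined strategies (type of record) step only while the stratum is non-empty.** [folklore] -/
theorem StrategyE.IsMenuDisciplined.stepsOnlyWhileNonempty (h : σ.IsMenuDisciplined N ν) : σ.StepsOnlyWhileNonempty N ν :=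
  StrategyE.IsDisciplinedBy.stepsOnlyWhileNonempty h

/-- **Menu-disciplined-over-a-fallback strategies step only while the stratum is non-empty, if the fallback does** (for the fallbacks of record:
047's `StrategyE.stepsOnlyWhileNonempty_ofStageOracleE` / `…_withBoundary_ofStageOracle`). [folklore] -/
theorem StrategyE.IsMenuDisciplinedOver.stepsOnlyWhileNonempty (h : StrategyE.IsMenuDisciplinedOver N ν τ σ) (hτ : τ.StepsOnlyWhileNonempty N ν) :
    σ.StepsOnlyWhileNonempty N ν :=
  StrategyE.IsDisciplinedByOver.stepsOnlyWhileNonempty h hτ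

/-- The hybrid of a menu-disciplined policy over a fallback with the property has the property. [folklore] -/
theorem StrategyE.IsMenuDisciplined.stepsOnlyWhileNonempty_hybrid (hπ : π.IsMenuDisciplined N ν) (hτ : τ.StepsOnlyWhileNonempty N ν) :
    (π.hybrid τ).StepsOnlyWhileNonempty N ν :=
  StrategyE.IsDisciplinedBy.stepsOnlyWhileNonempty_hybrid hπ hτ

/-- In particular over the boundary-aware stage-oracle fallback of record (Ω⁺E / CJS-with-boundary via 047's `StrategyE.ofStageOracleE`). [folklore] -/
theorem StrategyE.IsMenuDisciplined.stepsOnlyWhileNonempty_hybrid_ofStageOracleE (hπ : π.IsMenuDisciplined N ν) (ω : StageOracleE.{u}) :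
    (π.hybrid (StrategyE.ofStageOracleE ω)).StepsOnlyWhileNonempty N ν :=
  hπ.stepsOnlyWhileNonempty_hybrid (StrategyE.stepsOnlyWhileNonempty_ofStageOracleE ω N ν)

end Summit.ResolutionOfSingularities.ResolutionOfSingularities.Theorems.SigmaMaxModificationsCorridor3.Sigma

end
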